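import Summits.QuantumFields.BalabanUV.Beta.GAN24.CubicGaugeLetterLinearGrowth

/-!
# `BalabanUV.Beta.GAN24.ExitFaceSlotStaircaseDeep` — binder row G-an2-4 ∕ (CONV-C), W-slot (α-0), ROW (C) AT LEVELS `j ≥ 1`, the (γ) hand's memo
# `HOME/b2b-balaban-gan24-formalise-leaf-06/g54/C-LEVELS-GE1-g54.md` §29 («THE DEPTH TOWER», the slot letter): **THE PERIOD-`N` EXIT-FACE-GATED SLOT SUM OF THE VALUE THIRD
# JET `V_j = e3OfK Lc G_j (SrecAt … j)` IS THE COMMUTATOR OF THE VALUE HESSIAN WITH THE PERIOD-`N` STAIRCASE: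
# `Σ'_t [t_ν % N = N−1]·V_j ν t (x,z)_{inl a, inl b} = ½·E2 d Lc (j+1) (x,z)_{ab}·(⌊z_ν∕N⌋ − ⌊x_ν∕N⌋)`, FOR EVERY `N ≥ 1`** — and the two-face currents with INDEPENDENT
# slot period `N` and leg period `N′`: `Σ'_{s′} [s′_β % N′ = N′−1]·Σ'_t [t_ν % N = N−1]·V_j ν t (z,s′)_{bβ} = ½·Σ'_{s′} E2_{j+1}(z,s′)_{bβ}·⌊s′_ν∕N⌋·[s′_β % N′ = N′−1]`
# (every `j`, in-block root, E's pins, any `cΛ`). gen 53's `ExitFaceSlotStaircase` is the case `N = N′ = Lc`; the four-face charge of (C)_{≥1}'s contact side needs `N = N′ = Lc²`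
# (after `DressedVertexFaceBondSum.tsum_faceBond_vertexOfK_dressedStep`) and road-P2's tower classes need `N = Lc^m`
# (G-an2-4 CRUX TEAM (2), seat `b2b-balaban-gan24-formalise-leaf-06` = the (γ) hand, gen 54; journal INTENT I-leaf06-g54-5)

NOT IN PRINT; OUR BOOKKEEPING ([folklore] BY NAME: gen 52's L1′ `CubicGaugeLetterLinearGrowth.tsum_grad_mul_e3OfK_SrecAt_inl_inl` with the linear-growth potential
`⌊t_ν∕N⌋`, whose gradient D1's `ValueHessianLinearGauge.staircase_grad` identifies as the period-`N` exit-face slot; D1's `tsum_E2_mul_exitFace_eq_zero'` — both ALREADY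
stated at a free period `N`; 0 `def`, 0 cited fact, 0 `def … : Prop`, 0 sorry).
HONEST FRAMING (cell contract, verbatim): «discharging `BetaPertH` makes Bałaban's UV stability UNCONDITIONAL — a real constructive-QFT result; it is NOT the continuum
limit and NOT the Clay problem.»  HONEST DEPENDENCY (verbatim): «continuum YM on T⁴ ⇐ BetaPertH ∧ nine spine estimates (0/9 proved); BetaPertH ⇐ (D1) ∧ (D4) ∧ CAP+tail;
G-an2-4 gates asym, D1 and NE2/3/4.»
* §0 `stairN_grad`, `abs_stairN_le` (period `N`), `summable_E2_mul_linGrowth_faceN`, `summable_linGrowth_faceN_mul_E2` (face period free).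
* §1 **`faceSlot_e3OfK_eq_stairN`**.  §2 **`faceface_e3OfK_eq_stairN`**, **`faceface_e3OfK_eq_stairN_fst`**.
Asserts NO value of Bałaban's tables; discharges NOTHING of (C) ∕ (C)sym ∕ (Q-L) ∕ «T2Shape» ∕ «T2Drift» ∕ (hW, hWall); NEVER «G-an2-4 closed» as (CONV-C); NOT D1, NOT `BetaPertH`,
NOT continuum, NOT Clay.  2026-08-24; no existing file touched.
-/

noncomputable section

open Finset
open scoped BigOperators
open Literature.MathematicalPhysics.QuantumFieldTheory
open Literature.MathematicalPhysics.QuantumFieldTheory.Balaban1983to89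
open Literature.MathematicalPhysics.QuantumFieldTheory.Balaban1983to89.Beta
open B12Sec2to5 (l1 l1_nonneg)
open ExpKernelCalculus (Site MKer l1_sub_symm)
open AffineAveraging (box toSite unitVec)
open OneStepResolventKernel (Fib)
open OneStepKernelFamily (KInvStep)
open BalabanStepJetsSucc (E2 decays_E2)
open Summit.QuantumFields.BalabanUV.Beta.AxialDressingRooted (coDressKBmAt one_le_of_neZero)
open Summit.QuantumFields.BalabanUV.Beta.SpineRooted (e3OfK)
open Summit.QuantumFields.BalabanUV.Beta.WardLocusRecursive (SrecAt)
open Summit.QuantumFields.BalabanUV.Beta.GAN24.ValueHessianLinearGauge (staircase_grad abs_staircase_le summable_decay_mul_of_linGrowth tsum_E2_mul_exitFace_eq_zero' tsum_exitFace_mul_E2_eq_zero')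
open Summit.QuantumFields.BalabanUV.Beta.GAN24.CubicGaugeLetterLinearGrowth (tsum_grad_mul_e3OfK_SrecAt_inl_inl)

namespace Summit.QuantumFields.BalabanUV.Beta.GAN24.ExitFaceSlotStaircaseDeep

variable {d : ℕ} {Lc : ℕ} [NeZero Lc] {r : Fin (d + 1) → ℕ}

/-! ## §0 The period-`N` staircase and the face-weighted summabilities -/

omit [NeZero Lc] in
/-- [folklore] The period-`N` staircase's gradient is the period-`N` exit-face indicator: `⌊(t + e_κ)_ν∕N⌋ − ⌊t_ν∕N⌋ = [κ = ν]·[t_ν % N = N−1]` (`1 ≤ N`). -/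
theorem stairN_grad {N : ℕ} (hN : 1 ≤ N) (ν κ : Fin (d + 1)) (t : Fin (d + 1) → ℤ) :
    ((((t + unitVec κ) ν / (N : ℤ) : ℤ) : ℝ)) - (((t ν / (N : ℤ) : ℤ) : ℝ)) =
      if κ = ν then (if t ν % (N : ℤ) = (N : ℤ) - 1 then 1 else 0) else 0 := by
  have h := staircase_grad (d := d) hN 1 ν t κ
  rwa [one_mul, one_mul] at h

omit [NeZero Lc] in
/-- [folklore] Linear growth of the period-`N` staircase: `|⌊t_ν∕N⌋| ≤ 0 + 1·|t|₁`. -/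
theorem abs_stairN_le (N : ℕ) (ν : Fin (d + 1)) (t : Fin (d + 1) → ℤ) : |(((t ν / (N : ℤ) : ℤ) : ℝ))| ≤ 0 + 1 * l1 t := by
  have h := abs_staircase_le (d := d) N 1 ν t
  rwa [one_mul, abs_one] at h

/-- [folklore] Summability of `s′ ↦ E2_{j+1}(z,s′)_{bβ}·(λ s′·[s′_β % N′ = N′−1])` for `λ` of linear growth (any face period `N′`). -/
theorem summable_E2_mul_linGrowth_faceN (j : ℕ) {lam : (Fin (d + 1) → ℤ) → ℝ} {A B : ℝ} (hg : ∀ t, |lam t| ≤ A + B * l1 t) (N' : ℕ)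
    (z : Fin (d + 1) → ℤ) (b β : Fin (d + 1)) :
    Summable fun s' : Fin (d + 1) → ℤ =>
      E2 d Lc (j + 1) z s' (Sum.inl b) (Sum.inl β) * (lam s' * (if s' β % (N' : ℤ) = (N' : ℤ) - 1 then (1 : ℝ) else 0)) := by
  obtain ⟨δ, C, hδ, -, hE⟩ := decays_E2 (d := d) (Lc := Lc) (j + 1)
  have hg' : ∀ s' : Fin (d + 1) → ℤ, |lam s' * (if s' β % (N' : ℤ) = (N' : ℤ) - 1 then (1 : ℝ) else 0)| ≤ |A| + |B| * l1 s' := by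
    intro s'
    rw [abs_mul]
    have h1 : |(if s' β % (N' : ℤ) = (N' : ℤ) - 1 then (1 : ℝ) else 0)| ≤ 1 := by split_ifs <;> simp
    have h2 : |lam s'| ≤ |A| + |B| * l1 s' :=
      (hg s').trans (add_le_add (le_abs_self A) (mul_le_mul_of_nonneg_right (le_abs_self B) (l1_nonneg s')))
    calc |lam s'| * |(if s' β % (N' : ℤ) = (N' : ℤ) - 1 then (1 : ℝ) else 0)| ≤ (|A| + |B| * l1 s') * 1 :=
          mul_le_mul h2 h1 (abs_nonneg _) (add_nonneg (abs_nonneg A) (mul_nonneg (abs_nonneg B) (l1_nonneg s')))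
      _ = _ := by ring
  exact summable_decay_mul_of_linGrowth (K := fun s' => E2 d Lc (j + 1) z s' (Sum.inl b) (Sum.inl β)) (C := C) hδ z (fun s' => hE z s' _ _) hg'

/-- [folklore] The row twin: summability of `y ↦ (λ y·[y_α % N′ = N′−1])·E2_{j+1}(y,y₁)_{αa}`. -/
theorem summable_linGrowth_faceN_mul_E2 (j : ℕ) {lam : (Fin (d + 1) → ℤ) → ℝ} {A B : ℝ} (hg : ∀ t, |lam t| ≤ A + B * l1 t) (N' : ℕ)
    (y₁ : Fin (d + 1) → ℤ) (α a : Fin (d + 1)) :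
    Summable fun y : Fin (d + 1) → ℤ =>
      (lam y * (if y α % (N' : ℤ) = (N' : ℤ) - 1 then (1 : ℝ) else 0)) * E2 d Lc (j + 1) y y₁ (Sum.inl α) (Sum.inl a) := by
  obtain ⟨δ, C, hδ, -, hE⟩ := decays_E2 (d := d) (Lc := Lc) (j + 1)
  have hg' : ∀ y : Fin (d + 1) → ℤ, |lam y * (if y α % (N' : ℤ) = (N' : ℤ) - 1 then (1 : ℝ) else 0)| ≤ |A| + |B| * l1 y := by
    intro y
    rw [abs_mul]
    have h1 : |(if y α % (N' : ℤ) = (N' : ℤ) - 1 then (1 : ℝ) else 0)| ≤ 1 := by split_ifs <;> simp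
    have h2 : |lam y| ≤ |A| + |B| * l1 y :=
      (hg y).trans (add_le_add (le_abs_self A) (mul_le_mul_of_nonneg_right (le_abs_self B) (l1_nonneg y)))
    calc |lam y| * |(if y α % (N' : ℤ) = (N' : ℤ) - 1 then (1 : ℝ) else 0)| ≤ (|A| + |B| * l1 y) * 1 :=
          mul_le_mul h2 h1 (abs_nonneg _) (add_nonneg (abs_nonneg A) (mul_nonneg (abs_nonneg B) (l1_nonneg y)))
      _ = _ := by ring
  have h := summable_decay_mul_of_linGrowth (K := fun y => E2 d Lc (j + 1) y y₁ (Sum.inl α) (Sum.inl a)) (C := C) hδ y₁ (fun y => ?_) hg'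
  · exact h.congr fun y => mul_comm _ _
  · rw [l1_sub_symm]; exact hE y y₁ _ _

/-! ## §1 The period-`N` face-gated slot sum: the commutator of the value Hessian with the period-`N` staircase -/

/-- [folklore] **THE PERIOD-`N` EXIT-FACE-GATED SLOT SUM OF THE VALUE THIRD JET, IN CLOSED FORM** (every `j`, in-block root `toSite r`, pins
`(cE, cVH) = (Lc^{d+1}, −Lc^{d+1}·½·Lc^{d+1})`, any `cΛ`, ANY `N ≥ 1`): `Σ'_t [t_ν % N = N−1]·V_j ν t (x,z)_{inl a, inl b} = ½·E2 d Lc (j+1) (x,z)_{ab}·(⌊z_ν∕N⌋ − ⌊x_ν∕N⌋)` —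
L1′ with the period-`N` staircase. -/
theorem faceSlot_e3OfK_eq_stairN (hr : r ∈ box (d + 1) Lc) (cΛ : ℝ) (j : ℕ) {N : ℕ} (hN : 1 ≤ N) (ν : Fin (d + 1)) (x z : Fin (d + 1) → ℤ) (a b : Fin (d + 1)) :
    (∑' t : Fin (d + 1) → ℤ, (if t ν % (N : ℤ) = (N : ℤ) - 1 then
        e3OfK Lc (coDressKBmAt (toSite r) Lc (KInvStep (d := d) Lc j))
          (SrecAt d Lc (toSite r) ((Lc : ℝ) ^ (d + 1)) (-((Lc : ℝ) ^ (d + 1) * (1 / 2) * (Lc : ℝ) ^ (d + 1))) cΛ j) ν t x z (Sum.inl a) (Sum.inl b) else 0)) =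
      (1 / 2 : ℝ) * E2 d Lc (j + 1) x z (Sum.inl a) (Sum.inl b) * ((((z ν / (N : ℤ) : ℤ) : ℝ)) - (((x ν / (N : ℤ) : ℤ) : ℝ))) := by
  have key := tsum_grad_mul_e3OfK_SrecAt_inl_inl (d := d) hr cΛ j (g := fun t : Fin (d + 1) → ℤ => (((t ν / (N : ℤ) : ℤ) : ℝ))) (abs_stairN_le N ν) x z a b
  rw [← key]
  refine tsum_congr fun t => ?_
  rw [Finset.sum_eq_single ν (fun κ _ hκ => by rw [stairN_grad hN ν κ t, if_neg hκ, zero_mul]) (fun h => absurd (Finset.mem_univ ν) h),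
    stairN_grad hN ν ν t, if_pos rfl]
  split_ifs
  · rw [one_mul]
  · rw [zero_mul]

/-! ## §2 The two-face currents with independent slot and leg periods -/

/-- [folklore] **THE RIGHT TWO-FACE CURRENT IN CLOSED FORM, PERIODS `(N, N′)`** (open first leg `(b, z)`, period-`N′` exit-face weight on the second leg, period-`N` face gate on
the slot): `Σ'_{s′} [s′_β % N′ = N′−1]·Σ'_t [t_ν % N = N−1]·V_j ν t (z,s′)_{inl b, inl β} = ½·Σ'_{s′} E2 d Lc (j+1) (z,s′)_{bβ}·(⌊s′_ν∕N⌋·[s′_β % N′ = N′−1])` — §1 pointwise in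
`s′`; the `⌊z_ν∕N⌋`-half dies by D1 at period `N′`. -/
theorem faceface_e3OfK_eq_stairN (hr : r ∈ box (d + 1) Lc) (cΛ : ℝ) (j : ℕ) {N N' : ℕ} (hN : 1 ≤ N) (hN' : 1 ≤ N') (ν β : Fin (d + 1))
    (z : Fin (d + 1) → ℤ) (b : Fin (d + 1)) :
    (∑' s' : Fin (d + 1) → ℤ, (if s' β % (N' : ℤ) = (N' : ℤ) - 1 then (1 : ℝ) else 0) *
        ∑' t : Fin (d + 1) → ℤ, (if t ν % (N : ℤ) = (N : ℤ) - 1 then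
          e3OfK Lc (coDressKBmAt (toSite r) Lc (KInvStep (d := d) Lc j))
            (SrecAt d Lc (toSite r) ((Lc : ℝ) ^ (d + 1)) (-((Lc : ℝ) ^ (d + 1) * (1 / 2) * (Lc : ℝ) ^ (d + 1))) cΛ j) ν t z s' (Sum.inl b) (Sum.inl β) else 0)) =
      (1 / 2 : ℝ) * ∑' s' : Fin (d + 1) → ℤ, E2 d Lc (j + 1) z s' (Sum.inl b) (Sum.inl β) *
        ((((s' ν / (N : ℤ) : ℤ) : ℝ)) * (if s' β % (N' : ℤ) = (N' : ℤ) - 1 then (1 : ℝ) else 0)) := by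
  have hpt : ∀ s' : Fin (d + 1) → ℤ, (if s' β % (N' : ℤ) = (N' : ℤ) - 1 then (1 : ℝ) else 0) *
      (∑' t : Fin (d + 1) → ℤ, (if t ν % (N : ℤ) = (N : ℤ) - 1 then
        e3OfK Lc (coDressKBmAt (toSite r) Lc (KInvStep (d := d) Lc j))
          (SrecAt d Lc (toSite r) ((Lc : ℝ) ^ (d + 1)) (-((Lc : ℝ) ^ (d + 1) * (1 / 2) * (Lc : ℝ) ^ (d + 1))) cΛ j) ν t z s' (Sum.inl b) (Sum.inl β) else 0)) =
      (1 / 2 : ℝ) * (E2 d Lc (j + 1) z s' (Sum.inl b) (Sum.inl β) * ((((s' ν / (N : ℤ) : ℤ) : ℝ)) * (if s' β % (N' : ℤ) = (N' : ℤ) - 1 then (1 : ℝ) else 0)))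
        - (1 / 2 : ℝ) * (E2 d Lc (j + 1) z s' (Sum.inl b) (Sum.inl β) * (if s' β % (N' : ℤ) = (N' : ℤ) - 1 then (((z ν / (N : ℤ) : ℤ) : ℝ)) else 0)) := by
    intro s'
    rw [faceSlot_e3OfK_eq_stairN hr cΛ j hN ν z s' b β]
    split_ifs <;> ring
  have h1 := summable_E2_mul_linGrowth_faceN (d := d) (Lc := Lc) j (lam := fun s : Fin (d + 1) → ℤ => (((s ν / (N : ℤ) : ℤ) : ℝ))) (abs_stairN_le N ν) N' z b β
  have h2 : Summable fun s' : Fin (d + 1) → ℤ =>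
      E2 d Lc (j + 1) z s' (Sum.inl b) (Sum.inl β) * (if s' β % (N' : ℤ) = (N' : ℤ) - 1 then (((z ν / (N : ℤ) : ℤ) : ℝ)) else 0) := by
    have h := summable_E2_mul_linGrowth_faceN (d := d) (Lc := Lc) j (lam := fun _ : Fin (d + 1) → ℤ => (((z ν / (N : ℤ) : ℤ) : ℝ)))
      (A := |(((z ν / (N : ℤ) : ℤ) : ℝ))|) (B := 0) (fun _ => by rw [zero_mul, add_zero]) N' z b β
    refine h.congr fun s' => ?_
    split_ifs <;> simp
  rw [tsum_congr hpt, (h1.mul_left (1 / 2 : ℝ)).tsum_sub (h2.mul_left (1 / 2 : ℝ)), tsum_mul_left, tsum_mul_left,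
    tsum_E2_mul_exitFace_eq_zero' (Lc := Lc) (j + 1) hN' b β z ((((z ν / (N : ℤ) : ℤ) : ℝ))), mul_zero, sub_zero]

/-- [folklore] **THE LEFT TWO-FACE CURRENT IN CLOSED FORM, PERIODS `(N, N′)`** (period-`N′` exit-face weight on the first leg, open second leg `(a, x)`, period-`N` face gate on the
slot in direction `μ`): `Σ'_y [y_α % N′ = N′−1]·Σ'_t [t_μ % N = N−1]·V_j μ t (y,x)_{inl α, inl a} = −½·Σ'_y (⌊y_μ∕N⌋·[y_α % N′ = N′−1])·E2 d Lc (j+1) (y,x)_{αa}`. -/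
theorem faceface_e3OfK_eq_stairN_fst (hr : r ∈ box (d + 1) Lc) (cΛ : ℝ) (j : ℕ) {N N' : ℕ} (hN : 1 ≤ N) (hN' : 1 ≤ N') (μ α : Fin (d + 1))
    (x : Fin (d + 1) → ℤ) (a : Fin (d + 1)) :
    (∑' y : Fin (d + 1) → ℤ, (if y α % (N' : ℤ) = (N' : ℤ) - 1 then (1 : ℝ) else 0) *
        ∑' t : Fin (d + 1) → ℤ, (if t μ % (N : ℤ) = (N : ℤ) - 1 then
          e3OfK Lc (coDressKBmAt (toSite r) Lc (KInvStep (d := d) Lc j))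
            (SrecAt d Lc (toSite r) ((Lc : ℝ) ^ (d + 1)) (-((Lc : ℝ) ^ (d + 1) * (1 / 2) * (Lc : ℝ) ^ (d + 1))) cΛ j) μ t y x (Sum.inl α) (Sum.inl a) else 0)) =
      -(1 / 2 : ℝ) * ∑' y : Fin (d + 1) → ℤ, ((((y μ / (N : ℤ) : ℤ) : ℝ)) * (if y α % (N' : ℤ) = (N' : ℤ) - 1 then (1 : ℝ) else 0)) *
        E2 d Lc (j + 1) y x (Sum.inl α) (Sum.inl a) := by
  have hpt : ∀ y : Fin (d + 1) → ℤ, (if y α % (N' : ℤ) = (N' : ℤ) - 1 then (1 : ℝ) else 0) *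
      (∑' t : Fin (d + 1) → ℤ, (if t μ % (N : ℤ) = (N : ℤ) - 1 then
        e3OfK Lc (coDressKBmAt (toSite r) Lc (KInvStep (d := d) Lc j))
          (SrecAt d Lc (toSite r) ((Lc : ℝ) ^ (d + 1)) (-((Lc : ℝ) ^ (d + 1) * (1 / 2) * (Lc : ℝ) ^ (d + 1))) cΛ j) μ t y x (Sum.inl α) (Sum.inl a) else 0)) =
      (1 / 2 : ℝ) * ((if y α % (N' : ℤ) = (N' : ℤ) - 1 then (((x μ / (N : ℤ) : ℤ) : ℝ)) else 0) * E2 d Lc (j + 1) y x (Sum.inl α) (Sum.inl a))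
        - (1 / 2 : ℝ) * (((((y μ / (N : ℤ) : ℤ) : ℝ)) * (if y α % (N' : ℤ) = (N' : ℤ) - 1 then (1 : ℝ) else 0)) * E2 d Lc (j + 1) y x (Sum.inl α) (Sum.inl a)) := by
    intro y
    rw [faceSlot_e3OfK_eq_stairN hr cΛ j hN μ y x α a]
    split_ifs <;> ring
  have h2 := summable_linGrowth_faceN_mul_E2 (d := d) (Lc := Lc) j (lam := fun y : Fin (d + 1) → ℤ => (((y μ / (N : ℤ) : ℤ) : ℝ))) (abs_stairN_le N μ) N' x α a
  have h1 : Summable fun y : Fin (d + 1) → ℤ =>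
      (if y α % (N' : ℤ) = (N' : ℤ) - 1 then (((x μ / (N : ℤ) : ℤ) : ℝ)) else 0) * E2 d Lc (j + 1) y x (Sum.inl α) (Sum.inl a) := by
    have h := summable_linGrowth_faceN_mul_E2 (d := d) (Lc := Lc) j (lam := fun _ : Fin (d + 1) → ℤ => (((x μ / (N : ℤ) : ℤ) : ℝ)))
      (A := |(((x μ / (N : ℤ) : ℤ) : ℝ))|) (B := 0) (fun _ => by rw [zero_mul, add_zero]) N' x α a
    refine h.congr fun y => ?_
    split_ifs <;> simp
  rw [tsum_congr hpt, (h1.mul_left (1 / 2 : ℝ)).tsum_sub (h2.mul_left (1 / 2 : ℝ)), tsum_mul_left, tsum_mul_left,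
    tsum_exitFace_mul_E2_eq_zero' (Lc := Lc) (j + 1) hN' a α x ((((x μ / (N : ℤ) : ℤ) : ℝ))), mul_zero, zero_sub, neg_mul]

end Summit.QuantumFields.BalabanUV.Beta.GAN24.ExitFaceSlotStaircaseDeep

end
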